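import Summits.BirchSwinnertonDyer.BirchSwinnertonDyer.Theorems.CycTangentCMCycTangentBoundUniquenessLines
import Summits.BirchSwinnertonDyer.BirchSwinnertonDyer.Theorems.CycTangentCMCycTangentBoundInterpolationContinuation
import Summits.BirchSwinnertonDyer.BirchSwinnertonDyer.Theorems.CycTangentCMCycTangentBoundFrameUniqueness
import Summits.BirchSwinnertonDyer.Rank1Residual.X11b.CharacterSupply
import Summits.BirchSwinnertonDyer.Rank1Residual.X11b.UnrIntegersUnitPowers
import HarnessLib

set_option linter.dupNamespace false
set_option autoImplicit false

/-!
# Crux `CycTangentCM.CycTangentBound` (stmt-BirchSwinnertonDyer-22628), stub `stub_selfDual`: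
# UNIQUENESS OF THE `ψ⁻¹`-TWISTED TWO-VARIABLE FRAME AT FIXED PERIODS (the step `Ǧ = G`)

Seat `bsd-line-ctcm-p2` (line `tangent-cone-parity`, lead `bsd-line-ctcm-p1`). The registered stub
`stub_selfDual` (= the cite-only fact `DeShalit1987.thmII64_selfDual_functionalEquation_cm`) bundles,
beyond de Shalit II.6.4 as typed, the identification `Ǧ = G` of two frames
`IsKatzMeasure₂ ι v v̄ S κ₁ κ₂ γ₁ γ₂ ψ⁻¹ Ω δ Ω_p` of the SAME data ("print speaks of THE measure"; de
Shalit II.6.4 proof, p. 85: "enough admissible `ε_G` to separate points"). This file PROVES it in the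
kernel, for EVERY period triple `(Ω, δ, Ω_p)` and every generator pair:

* `isKatzMeasure₂_unique_of_cm` — `K` imaginary quadratic, `p` odd and split (`v ≠ v̄`, `ι` inducing
  `v`), `ψ` of infinity type `(1, 0)` unramified off `S`: two witnesses `G, G'` of
  `IsKatzMeasure₂ ι v v̄ S κ₁ κ₂ γ₁ γ₂ ψ⁻¹ Ω δ Ω_p` are EQUAL.

PROOF (all inputs kernel theorems). The lead's `isKatzMeasure₂_ext_of_lineSupplies` (p587325) reduces
to supplies on infinitely many pairwise non-proportional `ℤ_p`-lines through the pair. Take `Ψ₁ = ψ^{−N}`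
with `ψ^N` unramified everywhere (`exists_pow_forall_isUnramifiedAt`), type `(−N, 0)`; avatars of its
powers through the pair, `e∘χ₁ⁿ` (p584708), tamed so that `‖χ₁(σ) − 1‖ < ‖p‖` (p591594 §2); `χ₁`
factors through the split-prime line `κ_𝔭` (p3's saturation `exists_splitPrimeLine_factorsThroughZp`).
With `θ = θ_c` the outer action of a complex conjugation, the lines `κ_s = p(s+1)·κ_𝔭 − κ_𝔭∘θ`
(p591594 §3) carry `φ_s = χ₁^{p(s+1)}·(χ₁∘θ)⁻¹`, whose powers `φ_s^{pᵏ}` are the avatars of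
`Ψ₁^{Wa pᵏ}·(Ψ₁^{W pᵏ} ∘ c)⁻¹` (type `(−W a pᵏ N, W pᵏ N)`, so `ψ⁻¹ρ` has type `(−m, j)` with
`j < m`; continuations by p591209); the directions are pairwise non-proportional and the values
`φ_s(γ_s)^{pᵏ} → 1` are never `1`, both because `ker κ_𝔭` is not `θ`-stable — the avatar of a
type-`(k,0)` character, `k ≠ 0`, is ramified at `v` (p590734). Nothing about any curve is asserted;
supports, does not close, stmt-BirchSwinnertonDyer-22628. BSD is not proved by this.

References: [deShalit1987] II.4.12 Remark (iv), II.4.16 (49)–(50), II.4.17 (52)–(54), II.6.4 proof (p. 85);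
[Katz1978] (5.3.0); [Washington1997] §13.
-/

noncomputable section

open scoped NumberField Classical Topology
open Filter NumberField IsDedekindDomain Field
open Literature Literature.NumberTheory.GaloisRepresentations Literature.NumberTheory.EllipticCurves
open Summit.BirchSwinnertonDyer.Rank1Residual.X11b Summit.BirchSwinnertonDyer.Rank1Residual.X11b.LambdaSupply
open Summit.BirchSwinnertonDyer.Rank1Residual.X11b.Three.LambdaSupply
open Summit.BirchSwinnertonDyer.BirchSwinnertonDyer.Theorems.CycTangentCMCycTangentBoundUniquenessLines
open Summit.BirchSwinnertonDyer.BirchSwinnertonDyer.Theorems.CycTangentCMCycTangentBoundInterpolationContinuation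
open Summit.BirchSwinnertonDyer.BirchSwinnertonDyer.Theorems.CycTangentCMCycTangentBoundFrameUniqueness

namespace Summit.BirchSwinnertonDyer.BirchSwinnertonDyer.Theorems.CycTangentCMCycTangentBoundFrameUniquenessCM

variable {p : ℕ} [Fact p.Prime] {K : Type} [Field K] [NumberField K]

/-! ### §1. Small norms -/

/-- `‖u w⁻¹ − 1‖ < ε` for `‖u − 1‖, ‖w − 1‖ < ε` and `‖w‖ = 1`. [folklore] -/
theorem norm_mul_inv_sub_one_lt {u w : ℂ_[p]} (hw : ‖w‖ = 1) {ε : ℝ}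
    (hu1 : ‖u - 1‖ < ε) (hw1 : ‖w - 1‖ < ε) : ‖u * w⁻¹ - 1‖ < ε := by
  have hw0 : w ≠ 0 := norm_pos_iff.mp (by rw [hw]; exact one_pos)
  have e : u * w⁻¹ - 1 = w⁻¹ * ((u - 1) + -(w - 1)) := by field_simp; ring
  rw [e, norm_mul, norm_inv, hw, inv_one, one_mul]
  refine (IsUltrametricDist.norm_add_le_max _ _).trans_lt (max_lt hu1 ?_)
  rwa [norm_neg]

/-! ### §2. The uniqueness theorem -/

/-- **UNIQUENESS OF THE `ψ⁻¹`-TWISTED TWO-VARIABLE KATZ–DE SHALIT FRAME AT FIXED PERIODS.** For `K`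
imaginary quadratic, `p` odd and split in `K` (`v ≠ v̄` above `p`, `ι` inducing `v`), a Hecke character
`ψ` of `K` of infinity type `(1, 0)` unramified away from `S`, a generator pair
`(κ₁, κ₂; γ₁, γ₂)` and ANY period data `(Ω, δ, Ω_p)`: two witnesses of
`IsKatzMeasure₂ ι v v̄ S κ₁ κ₂ γ₁ γ₂ ψ⁻¹ Ω δ Ω_p` coincide. See the module docstring for the proof.
[cite: deShalit1987, II.4.16 (49)–(50) (p. 76–77), II.4.17 (52)–(54) (p. 77–78), II.6.4 proof (p. 85)]
[cite: Katz1978, (5.3.0)] -/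
theorem isKatzMeasure₂_unique_of_cm (hK : IsImaginaryQuadratic K) (hp2 : p ≠ 2)
    {ι : PadicAlgCl p ≃+* ℂ} {v vbar : HeightOneSpectrum (𝓞 K)}
    (hv : ((p : ℕ) : 𝓞 K) ∈ v.asIdeal) (hvbar : ((p : ℕ) : 𝓞 K) ∈ vbar.asIdeal) (hne : vbar ≠ v)
    (hι : ∀ (w : InfinitePlace K) (d : 𝓞 K), d ∈ v.asIdeal ↔ ‖ι.symm (w.embedding (d : K))‖ < 1)
    {S : Finset (HeightOneSpectrum (𝓞 K))}
    {ψ : HeckeCharacter K} (hψ : ψ.HasInfinityType (fun _ ↦ 1) (fun _ ↦ 0))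
    (hSunr : ∀ w : HeightOneSpectrum (𝓞 K), w ∉ S → ψ.IsUnramifiedAt w)
    {κ₁ κ₂ : ZpExtension K p} {γ₁ γ₂ : absoluteGaloisGroup K}
    (hpair : ZpExtension.IsTopGeneratorPair κ₁ κ₂ γ₁ γ₂)
    {Ω δ : ℂ} {Ωp : ℂ_[p]} {G G' : PowerSeries (PowerSeries (PadicComplexInt p))}
    (hG : IsKatzMeasure₂ ι v vbar S κ₁ κ₂ γ₁ γ₂ ψ⁻¹ Ω δ Ωp G)
    (hG' : IsKatzMeasure₂ ι v vbar S κ₁ κ₂ γ₁ γ₂ ψ⁻¹ Ω δ Ωp G') : G = G' := by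
  haveI : Algebra.IsQuadraticExtension ℚ K := ⟨hK.1⟩
  haveI : IsGalois ℚ K := inferInstance
  haveI : IsCMField K := hK.isCMField
  haveI : IsTotallyComplex K := hK.2
  have himag : ∀ w : InfinitePlace K, w.IsComplex := fun w ↦ hK.2.isComplex w
  have hp : p.Prime := Fact.out
  set e := (FramedRep.unitsContinuousMulEquivOfUnique (Fin 1) (PadicAlgCl p) :
    (PadicAlgCl p)ˣ →ₜ* GL (Fin 1) (PadicAlgCl p)) with he
  -- Step 1: `Ψ₁ = ψ^{-N}`, type `(-N, 0)`, unramified everywhere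
  obtain ⟨N, hN, hψN⟩ := exists_pow_forall_isUnramifiedAt ψ
  set Ψ₁ : HeckeCharacter K := (ψ ^ N)⁻¹ with hΨ₁
  have hΨ₁t : Ψ₁.HasInfinityType (fun _ ↦ -(N : ℤ)) (fun _ ↦ 0) := by
    have h := (HasInfinityType.pow_nat hψ N).inv
    convert h using 2 <;> simp
  have hΨ₁a : Ψ₁.IsAlgebraic :=
    (HeckeCharacter.isAlgebraic_iff_exists_hasInfinityType _).mpr ⟨_, _, hΨ₁t⟩
  have hΨ₁u : ∀ w : HeightOneSpectrum (𝓞 K), Ψ₁.IsUnramifiedAt w := fun w ↦ (hψN w).inv'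
  have hΨ₁pow_t : ∀ n : ℕ, (Ψ₁ ^ n).HasInfinityType (fun _ ↦ -((N * n : ℕ) : ℤ)) (fun _ ↦ 0) := by
    intro n
    have h := HasInfinityType.pow_nat hΨ₁t n
    convert h using 2 <;> push_cast <;> ring
  have hΨ₁pow_u : ∀ (n : ℕ) (w : HeightOneSpectrum (𝓞 K)), (Ψ₁ ^ n).IsUnramifiedAt w :=
    fun n w ↦ isUnramifiedAt_pow' (hΨ₁u w) n
  -- Step 2: avatars of the powers of `Ψ₁` through the pair, tamed
  obtain ⟨M, χ₀, hM, hall⟩ := CycTangentCMCycTangentBoundPairSupply.exists_isPAdicAvatarOf_pow_factorsThroughPair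
    ι hK.1 himag hΨ₁a (fun w _ ↦ hΨ₁u w) hpair
  obtain ⟨N₀, hN₀, hsmall₀⟩ := exists_pow_norm_sub_one_lt χ₀
  set χ₁ : absoluteGaloisGroup K →ₜ* (PadicAlgCl p)ˣ := χ₀ ^ N₀ with hχ₁
  set W : ℕ := M * N₀ with hW
  have hWpos : 0 < W := Nat.mul_pos hM hN₀
  have havatar : ∀ n : ℕ, IsPAdicAvatarOf ι (Ψ₁ ^ (W * n)) (e.comp (χ₁ ^ n)) := by
    intro n
    have h := (hall (N₀ * n)).1
    rw [hχ₁, ← pow_mul, hW, mul_assoc]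
    exact h
  have hpair_n : ∀ n : ℕ, FactorsThroughPair κ₁ κ₂ (e.comp (χ₁ ^ n)) := by
    intro n
    rw [hχ₁, ← pow_mul]
    exact (hall (N₀ * n)).2
  have hsmall : ∀ (n : ℕ) (σ : absoluteGaloisGroup K),
      ‖avatarValueAt (e.comp (χ₁ ^ n)) σ - 1‖ < ‖(p : ℂ_[p])‖ := by
    intro n σ
    rw [he, avatarValueAt_unitsChar_pow]
    exact (UnrUnits.norm_pow_sub_one_le (norm_avatarValueAt_eq_one _ σ).le n).trans_lt (hsmall₀ σ)
  -- Step 3: the split-prime line `κ` carrying `χ₁`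
  obtain ⟨κ, hκpair, hκinert, hsat⟩ := exists_splitPrimeLine_factorsThroughZp hK hp2 ι hv hvbar hne hι hpair
  have hχ₁κ' : FactorsThroughZp κ (e.comp χ₁) := by
    have h := hsat (Ψ₁ ^ (W * 1)) (-((N * (W * 1) : ℕ) : ℤ)) ∅ (e.comp (χ₁ ^ 1)) (hΨ₁pow_t _)
      (fun w _ ↦ hΨ₁pow_u _ w) (hΨ₁pow_u _ vbar) (havatar 1) (hpair_n 1) (hsmall 1)
    rwa [pow_one] at h
  have hχ₁κ : ∀ σ, κ σ = 1 → χ₁ σ = 1 := (factorsThroughZp_unitsChar_iff κ χ₁).mp hχ₁κ'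
  set γ : absoluteGaloisGroup K := κ.lift 1 with hγdef
  have hγ : κ.IsTopGenerator γ := κ.apply_lift 1
  -- Step 4: complex conjugation, its outer action `θ`
  obtain ⟨c, hc, hc2⟩ := exists_not_mem_range_absGaloisRestrict (K := ℚ) (L := K) (Rat.castHom ℝ) himag
  set θ := absGaloisOuterConj ℚ K c with hθ
  have hθθ : ∀ σ, θ (θ σ) = σ := fun σ ↦ by
    rw [hθ, ← absGaloisOuterConj_mul_apply, hc2, absGaloisOuterConj_one_apply]
  have hθres : ∀ σ, absGaloisRestrict ℚ K (θ σ) = c * absGaloisRestrict ℚ K σ * c⁻¹ :=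
    fun σ ↦ absGaloisRestrict_absGaloisOuterConj ℚ K c σ
  -- Step 5: non-degeneracy of the directions of `κ`, `κ ∘ θ`
  have hNW : (-((N * (W * 1) : ℕ) : ℤ)) ≠ 0 := by
    have : 0 < N * (W * 1) := Nat.mul_pos hN (by omega)
    omega
  have havatar1 : IsPAdicAvatarOf ι (Ψ₁ ^ (W * 1)) (e.comp χ₁) := by
    have h := havatar 1; rwa [pow_one] at h
  have hdet := toAdd_mul_ne_of_isPAdicAvatarOf ι hK hv hvbar hne hι hpair hκinert hNW (hΨ₁pow_t _)
    (hΨ₁pow_u _) havatar1 hχ₁κ hc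
  set d₁ := Multiplicative.toAdd (κ γ₁) with hd₁
  set d₂ := Multiplicative.toAdd (κ γ₂) with hd₂
  set d₁' := Multiplicative.toAdd (κ (θ γ₁)) with hd₁'
  set d₂' := Multiplicative.toAdd (κ (θ γ₂)) with hd₂'
  -- Step 6: the lines
  have hlines := fun s : ℕ ↦ exists_line_of_direction (p := p) hK hpair hκpair hγ θ hθθ (s + 1)
  choose κL γL hκLpair hγL hκLval hκLchar using hlines
  -- at most one line has `κ_s(γ₂) = 0`: shift past it
  have hval2 : ∀ s, Multiplicative.toAdd (κL s γ₂) = ((p * (s + 1) : ℕ) : ℤ_[p]) * d₂ - d₂' :=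
    fun s ↦ hκLval s γ₂
  have hval1 : ∀ s, Multiplicative.toAdd (κL s γ₁) = ((p * (s + 1) : ℕ) : ℤ_[p]) * d₁ - d₁' :=
    fun s ↦ hκLval s γ₁
  have huniq : ∀ s t, Multiplicative.toAdd (κL s γ₂) = 0 → Multiplicative.toAdd (κL t γ₂) = 0 → s = t := by
    intro s t hs ht
    rw [hval2] at hs ht
    by_contra hst
    have hd2 : d₂ = 0 := by
      have h1 : (((p * (s + 1) : ℕ) : ℤ_[p]) - ((p * (t + 1) : ℕ) : ℤ_[p])) * d₂ = 0 := by
        linear_combination hs - ht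
      rcases mul_eq_zero.mp h1 with h | h
      · exfalso
        have : ((p * (s + 1) : ℕ) : ℤ_[p]) = ((p * (t + 1) : ℕ) : ℤ_[p]) := sub_eq_zero.mp h
        have h2 : p * (s + 1) = p * (t + 1) := by exact_mod_cast this
        have := Nat.eq_of_mul_eq_mul_left hp.pos h2
        omega
      · exact h
    have hd2' : d₂' = 0 := by rw [hd2, mul_zero, zero_sub, neg_eq_zero] at hs; exact hs
    apply hdet
    rw [hd2, hd2', mul_zero, zero_mul]
  obtain ⟨shift, hshift⟩ : ∃ shift : ℕ, ∀ s, Multiplicative.toAdd (κL (s + shift) γ₂) ≠ 0 := by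
    by_cases hbad : ∃ s₀, Multiplicative.toAdd (κL s₀ γ₂) = 0
    · obtain ⟨s₀, hs₀⟩ := hbad
      refine ⟨s₀ + 1, fun s hs ↦ ?_⟩
      have := huniq _ _ hs hs₀
      omega
    · push Not at hbad
      exact ⟨0, fun s ↦ hbad _⟩
  -- the final family
  set κF : ℕ → ZpExtension K p := fun s ↦ κL (s + shift) with hκF
  set γF : ℕ → absoluteGaloisGroup K := fun s ↦ γL (s + shift) with hγF
  set aF : ℕ → ℕ := fun s ↦ p * (s + shift + 1) with haF
  have haFpos : ∀ s, 0 < aF s := fun s ↦ Nat.mul_pos hp.pos (Nat.succ_pos _)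
  have hprop : ∀ s t, s ≠ t → Multiplicative.toAdd (κF s γ₁) * Multiplicative.toAdd (κF t γ₂) ≠
      Multiplicative.toAdd (κF t γ₁) * Multiplicative.toAdd (κF s γ₂) := by
    intro s t hst heq
    simp only [hκF, hval1, hval2] at heq
    have key : (((p * (s + shift + 1) : ℕ) : ℤ_[p]) - ((p * (t + shift + 1) : ℕ) : ℤ_[p])) *
        (d₁' * d₂ - d₁ * d₂') = 0 := by
      linear_combination heq
    rcases mul_eq_zero.mp key with h | h
    · have : ((p * (s + shift + 1) : ℕ) : ℤ_[p]) = ((p * (t + shift + 1) : ℕ) : ℤ_[p]) := sub_eq_zero.mp h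
      have h2 : p * (s + shift + 1) = p * (t + shift + 1) := by exact_mod_cast this
      have := Nat.eq_of_mul_eq_mul_left hp.pos h2
      omega
    · exact hdet (by linear_combination -h)
  -- Step 7: the characters `φ_s = χ₁^{a_s} (χ₁∘θ)⁻¹` through `κF s`
  set φ : ℕ → (absoluteGaloisGroup K →ₜ* (PadicAlgCl p)ˣ) :=
    fun s ↦ χ₁ ^ (aF s) * (χ₁.comp θ)⁻¹ with hφdef
  have hφκ : ∀ s, FactorsThroughZp (κF s) (e.comp (φ s)) := fun s ↦
    (factorsThroughZp_unitsChar_iff (κF s) (φ s)).mpr (hκLchar (s + shift) χ₁ hχ₁κ)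
  have hφpow : ∀ s n, (φ s) ^ n = χ₁ ^ (aF s * n) * ((χ₁ ^ n).comp θ)⁻¹ := by
    intro s n
    refine ContinuousMonoidHom.ext fun σ ↦ ?_
    simp only [hφdef, ContinuousMonoidHom.pow_apply, ContinuousMonoidHom.mul_apply, unitsChar_inv_apply,
      ContinuousMonoidHom.coe_comp, Function.comp_apply, mul_pow, inv_pow, pow_mul]
  -- small values of `φ_s`
  have hφsmall : ∀ s σ, ‖avatarValueAt (e.comp (φ s)) σ - 1‖ < ‖(p : ℂ_[p])‖ := by
    intro s σ
    have h1 := hsmall (aF s) σ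
    have h2 := hsmall 1 (θ σ)
    rw [pow_one] at h2
    rw [hφdef, he, avatarValueAt_unitsChar_mul, ← he]
    have e3 : avatarValueAt (e.comp (χ₁.comp θ)⁻¹) σ = (avatarValueAt (e.comp χ₁) (θ σ))⁻¹ := by
      rw [he, avatarValueAt_unitsChar, avatarValueAt_unitsChar, unitsChar_inv_apply,
        ContinuousMonoidHom.coe_comp, Function.comp_apply, Units.val_inv_eq_inv_val, PadicComplex.coe_eq,
        PadicComplex.coe_eq, map_inv₀]
    rw [e3]
    exact norm_mul_inv_sub_one_lt (norm_avatarValueAt_eq_one _ _) h1 h2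
  -- `φ_s(γ_s)` is a principal unit, not `1`
  have hφne : ∀ s, avatarValueAt (e.comp (φ s)) (γF s) ≠ 1 := by
    intro s h1
    -- then `φ_s ≡ 1`
    have hall1 : ∀ σ, avatarValueAt (e.comp (φ s)) σ = 1 := fun σ ↦ by
      rw [ZpExtension.avatarValueAt_eq_onePlusPow (hφκ s) (hγL (s + shift)) σ, h1, sub_self]
      have h := IntSeries.norm_onePlusPow_sub_one_le (Multiplicative.toAdd (κF s σ)) (x := (0 : ℂ_[p]))
        (by rw [norm_zero]; exact one_pos)
      rw [norm_zero] at h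
      exact sub_eq_zero.mp (norm_le_zero_iff.mp h)
    -- hence `χ₁` kills `θ(I_𝔓)` for `𝔓 ∣ v̄`: `e∘χ₁` unramified at `v`
    have hχθ : ∀ 𝔓 ∈ vbar.primesAbove, ∀ τ ∈ 𝔓.inertia (absoluteGaloisGroup K), χ₁ (θ τ) = 1 := by
      intro 𝔓 h𝔓 τ hτ
      have hκτ : κ τ = 1 := ZpExtension.mem_kerSubgroup.mp (hκinert 𝔓 h𝔓 hτ)
      have hχτ : χ₁ τ = 1 := hχ₁κ τ hκτ
      have h := hall1 τ
      rw [he, avatarValueAt_unitsChar, hφdef, ContinuousMonoidHom.mul_apply, ContinuousMonoidHom.pow_apply,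
        hχτ, one_pow, one_mul, unitsChar_inv_apply, ContinuousMonoidHom.coe_comp, Function.comp_apply,
        ← UniformSpace.Completion.coe_one, UniformSpace.Completion.coe_inj] at h
      exact inv_eq_one.mp (Units.ext h)
    have hunrθ : (FramedGaloisRep.outerConj c (e.comp χ₁)).IsUnramifiedAt vbar := by
      intro 𝔓 h𝔓 τ hτ
      rw [FramedGaloisRep.outerConj_apply, ← hθ, ContinuousMonoidHom.coe_comp, Function.comp_apply,
        hχθ 𝔓 h𝔓 τ hτ, map_one]
    have hcbar : absGaloisQuot ℚ K c ≠ 1 := fun h1 ↦ by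
      obtain ⟨x, hx⟩ := (absGaloisQuot_eq_one_iff ℚ K c).1 h1
      exact hc ⟨x, hx⟩
    have hunrv : FramedGaloisRep.IsUnramifiedAt v (e.comp χ₁) := by
      have h := (FramedGaloisRep.isUnramifiedAt_outerConj_iff c (e.comp χ₁) vbar).mp hunrθ
      rwa [CycTangentCMCycTangentBoundAvatarRamified.smul_eq_of_ne_one hK.1 hv hvbar hne hcbar] at h
    exact CycTangentCMCycTangentBoundAvatarRamified.not_isUnramifiedAt_avatar_of_hasInfinityType_ne_zero ι hK
      hv hvbar hne hι hNW (hΨ₁pow_t _) (T := ∅) (fun w _ ↦ hΨ₁pow_u _ w) (hΨ₁pow_u _ v) havatar1 hunrv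
  -- Step 8: the supply data
  set ρ : ℕ → ℕ → HeckeCharacter K := fun s k ↦
    Ψ₁ ^ (W * (aF s * p ^ k)) * (HeckeCharacter.galConj (IsCMField.complexConj K) (Ψ₁ ^ (W * p ^ k)))⁻¹
    with hρdef
  set r : ℕ → ℕ → FramedGaloisRep K (PadicAlgCl p) 1 := fun s k ↦ e.comp ((φ s) ^ (p ^ k)) with hrdef
  set m : ℕ → ℕ → ℕ := fun s k ↦ 1 + N * (W * (aF s * p ^ k)) with hmdef
  set j : ℕ → ℕ → ℕ := fun s k ↦ N * (W * p ^ k) with hjdef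
  have hr : ∀ s k, IsPAdicAvatarOf ι (ρ s k) (r s k) := by
    intro s k
    have h1 : IsPAdicAvatarOf ι (Ψ₁ ^ (W * (aF s * p ^ k))) (e.comp (χ₁ ^ (aF s * p ^ k))) := havatar _
    have h2 : IsPAdicAvatarOf ι (HeckeCharacter.galConj (IsCMField.complexConj K) (Ψ₁ ^ (W * p ^ k)))
        (e.comp ((χ₁ ^ p ^ k).comp θ)) := by
      have h := isPAdicAvatarOf_galConj_complexConj_comp hK.1 ι (havatar (p ^ k)) hc hθres
      exact h
    have h3 := isPAdicAvatarOf_mul ι h1 (isPAdicAvatarOf_inv ι h2)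
      (hram_of_forall (fun w _ ↦ hΨ₁pow_u _ w) (fun w _ ↦ ?_))
    · rw [hrdef, hρdef]
      simp only
      rw [hφpow s (p ^ k)]
      exact h3
    · rw [← inv_inv (HeckeCharacter.galConj _ _)]
      refine HeckeCharacter.IsUnramifiedAt.inv' ?_
      rw [inv_inv, HeckeCharacter.isUnramifiedAt_galConj_iff]
      exact hΨ₁pow_u _ _
  have hκr : ∀ s k, FactorsThroughZp (κF s) (r s k) := fun s k ↦ factorsThroughZp_unitsChar_pow _ (hφκ s) _
  have hjm : ∀ s k, j s k < m s k := by
    intro s k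
    have h1 : W * p ^ k ≤ W * (aF s * p ^ k) :=
      Nat.mul_le_mul_left _ (Nat.le_mul_of_pos_left _ (haFpos s))
    have h2 : N * (W * p ^ k) ≤ N * (W * (aF s * p ^ k)) := Nat.mul_le_mul_left _ h1
    show N * (W * p ^ k) < 1 + N * (W * (aF s * p ^ k))
    omega
  have hinf : ∀ s k, (ψ⁻¹ * ρ s k).HasInfinityType (fun _ ↦ -(m s k : ℤ)) (fun _ ↦ (j s k : ℤ)) := by
    intro s k
    have h := hψ.inv.mul' ((hΨ₁pow_t (W * (aF s * p ^ k))).mul'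
      ((hΨ₁pow_t (W * p ^ k)).galConj_complexConj.inv))
    show (ψ⁻¹ * (Ψ₁ ^ (W * (aF s * p ^ k)) *
        (HeckeCharacter.galConj (IsCMField.complexConj K) (Ψ₁ ^ (W * p ^ k)))⁻¹)).HasInfinityType
      (fun _ ↦ -((1 + N * (W * (aF s * p ^ k)) : ℕ) : ℤ)) (fun _ ↦ ((N * (W * p ^ k) : ℕ) : ℤ))
    convert h using 2 <;> simp only [Pi.add_apply, Pi.neg_apply] <;> push_cast <;> ring
  have hunr : ∀ s k (w : HeightOneSpectrum (𝓞 K)), w ∉ S → w ≠ vbar → (ψ⁻¹ * ρ s k).IsUnramifiedAt w := by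
    intro s k w hw _
    refine (hSunr w hw).inv'.mul' ((hΨ₁pow_u _ w).mul' ?_)
    rw [← inv_inv (HeckeCharacter.galConj _ _)]
    refine HeckeCharacter.IsUnramifiedAt.inv' ?_
    rw [inv_inv, HeckeCharacter.isUnramifiedAt_galConj_iff]
    exact hΨ₁pow_u _ _
  have hL : ∀ s k, LFunction.HasEntireContinuation (heckeLFunction (ψ⁻¹ * ρ s k)) :=
    fun s k ↦ hasEntireContinuation_of_hasInfinityType hK (hjm s k) (hinf s k)
  have hrval : ∀ s k, avatarValueAt (r s k) (γF s) = avatarValueAt (e.comp (φ s)) (γF s) ^ p ^ k :=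
    fun s k ↦ by rw [hrdef, he, avatarValueAt_unitsChar_pow]
  have hlim : ∀ s, Tendsto (fun k ↦ avatarValueAt (r s k) (γF s)) atTop (𝓝 1) := by
    intro s
    have h := tendsto_pow_prime_pow_padicComplex
      (ZpExtension.norm_avatarValueAt_sub_one_lt (hφκ s) (hγL (s + shift)))
    exact h.congr fun k ↦ (hrval s k).symm
  have hne' : ∀ s, ∃ᶠ k in atTop, avatarValueAt (r s k) (γF s) ≠ 1 := by
    intro s
    refine (Filter.Eventually.of_forall fun k hk ↦ ?_).frequently
    rw [hrval] at hk
    exact hφne s (avatarValueAt_torsionFree_of_norm_sub_one_lt (hφsmall s) (γF s) k hk)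
  exact isKatzMeasure₂_ext_of_lineSupplies hG hG' κF γF (fun s ↦ hκLpair _) (fun s ↦ hγL _) hshift hprop
    ρ r m j hr hκr hjm hinf hunr hL hlim hne'

end Summit.BirchSwinnertonDyer.BirchSwinnertonDyer.Theorems.CycTangentCMCycTangentBoundFrameUniquenessCM

end
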